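import Mathlib

/-!
# Stub `stub_smoothingFamily` (line `einstein-bulk-transfer`, crux `AhHadamardFilling`)

For a continuous `u` on a closed smooth `4`-manifold `M` we build `U : M × ℝ → ℝ`, continuous,
`U (x, 0) = u x`, smooth off `λ = 0`, with `λ U` of class `C¹` and `d(λ U)(x, 0) (v, s) = s u x`.
Construction: Whitney-embed `M` into `E = ℝ^N` by `e`, extend `u` to a compactly supported
continuous `ū` on `E` (Tietze, Urysohn), take smooth approximants `g m`, `|g m - ū| ≤ 2⁻ᵐ`,
`support (g m) ⊆ support ū` (`Continuous.exists_contDiff_approx`), re-index them so that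
`‖D (h k)‖ ≤ k + c₀` (`h k := g (Nat.findGreatest (C · ≤ k) k)`, `C m` a bound of `‖D (g m)‖`),
and interpolate in logarithmic time `t = -log |μ|`, `k = ⌊t⌋₊`, `θ τ := smoothTransition (4τ-1)`:
`V (z, μ) := h k z + θ (t - k) (h (k+1) z - h k z)`. Then `|μ| ‖D_z V‖ ≤ 3 e^{-k} (k + 1 + c₀) → 0`
and `|μ ∂_μ V| = |∂_t V| ≤ ‖θ'‖ |h (k+1) - h k| → 0`, i.e. `μ V` is `C¹` at `μ = 0` with derivative
`ū z • snd`; finally `U (x, λ) := V (e x, λ)`.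
-/

noncomputable section

set_option linter.dupNamespace false

open scoped Manifold ContDiff Topology
open Set Function Bundle Filter

namespace Summit.SmoothPoincare4.SmoothPoincare4.Cruxes.AhHadamardFilling.EinsteinBulkTransfer

namespace SmoothingFamily

/-- Eventually near a point of `X × {0}`, `|q.2| < ρ`. -/
theorem eventually_abs_snd_lt {X : Type*} [TopologicalSpace X] (p : X × ℝ) (hp : p.2 = 0)
    {ρ : ℝ} (hρ : 0 < ρ) : ∀ᶠ q : X × ℝ in 𝓝 p, |q.2| < ρ := by
  have h0 : ∀ᶠ μ in 𝓝 p.2, |μ| < ρ := by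
    rw [hp]
    filter_upwards [Metric.ball_mem_nhds (0 : ℝ) hρ] with μ hμ
    rwa [mem_ball_zero_iff, Real.norm_eq_abs] at hμ
  exact h0.prod_inr_nhds p.1

/-- Near any `t₀` the strip index `⌊t⌋₊` may be frozen at `⌊t₀⌋₊`, for strip interpolants `F j`
that glue: `F j z t = F (j+1) z t` for `t ∈ [j + 1/2, j + 1]`. -/
theorem floor_strip_eventuallyEq {X : Type*} (F : ℕ → X → ℝ → ℝ)
    (hglue : ∀ (j : ℕ) (z : X) (t : ℝ), (j : ℝ) + 1 / 2 ≤ t → t ≤ j + 1 → F j z t = F (j + 1) z t)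
    (t₀ : ℝ) : ∀ᶠ t in 𝓝 t₀, ∀ z, F ⌊t⌋₊ z t = F ⌊t₀⌋₊ z t := by
  rcases Nat.eq_zero_or_pos ⌊t₀⌋₊ with hk | hk
  · filter_upwards [Iio_mem_nhds (Nat.floor_eq_zero.mp hk)] with t ht z
    rw [hk, Nat.floor_eq_zero.mpr ht]
  obtain ⟨j, hj⟩ : ∃ j, ⌊t₀⌋₊ = j + 1 := ⟨⌊t₀⌋₊ - 1, by omega⟩
  have ht₀ : 0 ≤ t₀ :=
    le_of_not_gt fun hn => by simp [Nat.floor_eq_zero.2 (hn.trans one_pos)] at hk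
  have h1 : ((j + 1 : ℕ) : ℝ) ≤ t₀ := hj ▸ Nat.floor_le ht₀
  have h2 : t₀ < ((j + 1 : ℕ) : ℝ) + 1 := hj ▸ Nat.lt_floor_add_one t₀
  push_cast at h1 h2
  rw [hj]
  filter_upwards [Ioo_mem_nhds (show (j : ℝ) + 1 / 2 < t₀ by linarith) h2] with t ht z
  rcases lt_or_ge t ((j : ℝ) + 1) with hlt | hge
  · rw [(Nat.floor_eq_iff (by linarith [ht.1])).2 ⟨by linarith [ht.1], hlt⟩]
    exact hglue j z t (by linarith [ht.1]) hlt.le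
  · rw [(Nat.floor_eq_iff (by linarith [ht.1])).2
      ⟨by exact_mod_cast hge, by push_cast; linarith [ht.2]⟩]

variable {E : Type*} [NormedAddCommGroup E] [NormedSpace ℝ E]

/-- The `k`-th strip interpolant `h k + θ · (h (k+1) - h k)`,
`θ = smoothTransition (4 (t - k) - 1)`, `t = -log |μ|`, is smooth off `μ = 0`, with the key estimate
`‖μ • D‖ ≤ 3 |μ| (k + 1 + c₀) + 4 |h (k+1) z - h k z| |smoothTransition' (4 (t - k) - 1)|`. -/
theorem strip_contDiffAt_norm_le {h : ℕ → E → ℝ} {c₀ : ℝ} (hs : ∀ k, ContDiff ℝ ∞ (h k))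
    (hd : ∀ k z, ‖fderiv ℝ (h k) z‖ ≤ k + c₀) (k : ℕ) (p : E × ℝ) (hp : p.2 ≠ 0) :
    ContDiffAt ℝ ∞ (fun q : E × ℝ => h k q.1 +
      Real.smoothTransition (4 * (-Real.log q.2 - k) - 1) * (h (k + 1) q.1 - h k q.1)) p ∧
    ‖p.2 • fderiv ℝ (fun q : E × ℝ => h k q.1 +
      Real.smoothTransition (4 * (-Real.log q.2 - k) - 1) * (h (k + 1) q.1 - h k q.1)) p‖ ≤
      |p.2| * (3 * ((k : ℝ) + 1 + c₀)) + |h (k + 1) p.1 - h k p.1| *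
        (4 * |deriv Real.smoothTransition (4 * (-Real.log p.2 - k) - 1)|) := by
  have hc₀ : 0 ≤ c₀ := by simpa using (norm_nonneg _).trans (hd 0 0)
  have hι : ContDiffAt ℝ ∞ (fun q : E × ℝ => 4 * (-Real.log q.2 - k) - 1) p :=
    (contDiffAt_const.mul ((contDiffAt_snd.log hp).neg.sub contDiffAt_const)).sub contDiffAt_const
  have hA' : ∀ j, ContDiffAt ℝ ∞ (fun q : E × ℝ => h j q.1) p := fun j =>
    (hs j).contDiffAt.comp p contDiffAt_fst
  refine ⟨(hA' k).add (((Real.smoothTransition.contDiffAt (n := ⊤)).comp p hι).mul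
    ((hA' _).sub (hA' _))), ?_⟩
  have hA : ∀ j, HasFDerivAt (fun q : E × ℝ => h j q.1)
      ((fderiv ℝ (h j) p.1).comp (ContinuousLinearMap.fst ℝ E ℝ)) p := fun j =>
    (((hs j).differentiable (by simp)) p.1).hasFDerivAt.comp p hasFDerivAt_fst
  have hθ : HasFDerivAt (fun q : E × ℝ => Real.smoothTransition (4 * (-Real.log q.2 - k) - 1))
      ((deriv Real.smoothTransition (4 * (-Real.log p.2 - k) - 1) * (4 * -(p.2)⁻¹)) •
        ContinuousLinearMap.snd ℝ E ℝ) p :=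
    ((((Real.smoothTransition.contDiff (n := ⊤)).differentiable (by simp)) _).hasDerivAt.comp
      p.2 ((((Real.hasDerivAt_log hp).neg.sub_const _).const_mul 4).sub_const 1)).comp_hasFDerivAt
        p hasFDerivAt_snd
  have hΦ : HasFDerivAt (fun q : E × ℝ => h k q.1 +
      Real.smoothTransition (4 * (-Real.log q.2 - k) - 1) * (h (k + 1) q.1 - h k q.1)) _ p :=
    (hA k).add (hθ.mul ((hA (k + 1)).sub (hA k)))
  rw [hΦ.fderiv]
  refine ContinuousLinearMap.opNorm_le_bound _ (by positivity) fun q => ?_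
  have hq2 : |q.2| ≤ ‖q‖ := by simpa [Real.norm_eq_abs] using norm_snd_le q
  have hB : ∀ j : ℕ, (j : ℝ) ≤ k + 1 → |fderiv ℝ (h j) p.1 q.1| ≤ ((k : ℝ) + 1 + c₀) * ‖q‖ :=
    fun j hj => (Real.norm_eq_abs _ ▸ (fderiv ℝ (h j) p.1).le_opNorm q.1).trans
      (mul_le_mul (by linarith [hd j p.1]) (norm_fst_le q) (norm_nonneg _) (by positivity))
  have hϑ : |Real.smoothTransition (4 * (-Real.log p.2 - k) - 1)| ≤ 1 :=
    abs_le.2 ⟨by linarith [Real.smoothTransition.nonneg (4 * (-Real.log p.2 - k) - 1)],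
      Real.smoothTransition.le_one _⟩
  simp only [smul_apply, add_apply, ContinuousLinearMap.comp_apply, ContinuousLinearMap.coe_fst',
    ContinuousLinearMap.coe_snd', sub_apply, smul_eq_mul, Real.norm_eq_abs]
  set a := fderiv ℝ (h k) p.1 q.1
  set b := fderiv ℝ (h (k + 1)) p.1 q.1
  set Δ := h (k + 1) p.1 - h k p.1
  set ϑ := Real.smoothTransition (4 * (-Real.log p.2 - k) - 1)
  set ϑ' := deriv Real.smoothTransition (4 * (-Real.log p.2 - k) - 1)
  calc _ = |p.2 * a + p.2 * ϑ * (b - a) - 4 * (Δ * ϑ' * q.2)| := by congr 1; field_simp; ring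
    _ ≤ |p.2 * a| + |p.2 * ϑ * (b - a)| + |4 * (Δ * ϑ' * q.2)| :=
        (abs_sub _ _).trans (add_le_add (abs_add_le _ _) le_rfl)
    _ = |p.2| * |a| + |p.2| * |ϑ| * |b - a| + 4 * (|Δ| * |ϑ'| * |q.2|) := by
        simp only [abs_mul, Nat.abs_ofNat]
    _ ≤ |p.2| * (((k : ℝ) + 1 + c₀) * ‖q‖) + |p.2| * 1 * (((k : ℝ) + 1 + c₀) * ‖q‖ +
          ((k : ℝ) + 1 + c₀) * ‖q‖) + 4 * (|Δ| * |ϑ'| * ‖q‖) := by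
        gcongr
        · exact hB k (by linarith)
        · exact (abs_sub _ _).trans
            (add_le_add (hB (k + 1) (by push_cast; rfl)) (hB k (by linarith)))
    _ = (|p.2| * (3 * ((k : ℝ) + 1 + c₀)) + |Δ| * (4 * |ϑ'|)) * ‖q‖ := by ring

/-- **The analytic core** on a normed space `E`: from smooth approximants `h k → ubar` (uniformly)
with linear derivative budget `‖D (h k)‖ ≤ k + c₀`, a continuous family `V` on `E × ℝ` with
`V (·, 0) = ubar`, smooth off `E × {0}`, with `μ V` of class `C¹` and
`d(μ V) (z, 0) = ubar z • snd`. -/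
theorem exists_family {ubar : E → ℝ} {h : ℕ → E → ℝ} {c₀ : ℝ} (hu : Continuous ubar)
    (hs : ∀ k, ContDiff ℝ ∞ (h k)) (hd : ∀ k z, ‖fderiv ℝ (h k) z‖ ≤ k + c₀)
    (ha : ∀ ε > 0, ∃ K : ℕ, ∀ k ≥ K, ∀ z, |h k z - ubar z| ≤ ε) :
    ∃ V : E × ℝ → ℝ, (∀ z, V (z, 0) = ubar z) ∧ (∀ p : E × ℝ, p.2 ≠ 0 → ContDiffAt ℝ ∞ V p) ∧
      Continuous V ∧ ContDiff ℝ 1 (fun p : E × ℝ => p.2 * V p) ∧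
      ∀ p : E × ℝ, p.2 = 0 →
        HasFDerivAt (fun q : E × ℝ => q.2 * V q) (ubar p.1 • ContinuousLinearMap.snd ℝ E ℝ) p := by
  have hc₀ : 0 ≤ c₀ := by simpa using (norm_nonneg _).trans (hd 0 0)
  -- The family `V`, in logarithmic time `t = -log |μ|`, strip index `k = ⌊t⌋₊`.
  set V : E × ℝ → ℝ := fun p => if p.2 = 0 then ubar p.1 else h ⌊-Real.log p.2⌋₊ p.1 +
    Real.smoothTransition (4 * (-Real.log p.2 - ⌊-Real.log p.2⌋₊) - 1) *
      (h (⌊-Real.log p.2⌋₊ + 1) p.1 - h ⌊-Real.log p.2⌋₊ p.1) with hV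
  have hV0 : ∀ p : E × ℝ, p.2 = 0 → V p = ubar p.1 := fun p hp => by simp [hV, hp]
  -- Off the axis, `V` is locally the `⌊t₀⌋₊`-th strip interpolant, hence smooth.
  have V_eq : ∀ p : E × ℝ, p.2 ≠ 0 → V =ᶠ[𝓝 p] fun q : E × ℝ => h ⌊-Real.log p.2⌋₊ q.1 +
      Real.smoothTransition (4 * (-Real.log q.2 - ⌊-Real.log p.2⌋₊) - 1) *
        (h (⌊-Real.log p.2⌋₊ + 1) q.1 - h ⌊-Real.log p.2⌋₊ q.1) := by
    intro p hp
    have hglue := floor_strip_eventuallyEq (fun (j : ℕ) (z : E) (t : ℝ) => h j z +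
      Real.smoothTransition (4 * (t - j) - 1) * (h (j + 1) z - h j z)) (fun j z t h1 h2 => by
        simp only [Real.smoothTransition.one_of_one_le (show (1 : ℝ) ≤ 4 * (t - j) - 1 by linarith),
          Real.smoothTransition.zero_of_nonpos
            (show 4 * (t - ((j + 1 : ℕ) : ℝ)) - 1 ≤ 0 by push_cast; linarith)]
        ring) (-Real.log p.2)
    filter_upwards [((eventually_ne_nhds hp).and
      ((Real.continuousAt_log hp).neg.tendsto.eventually hglue)).prod_inr_nhds p.1] with q hq
    simp only [hV, if_neg hq.1]
    exact hq.2 q.1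
  have V_smooth : ∀ p : E × ℝ, p.2 ≠ 0 → ContDiffAt ℝ ∞ V p := fun p hp =>
    (strip_contDiffAt_norm_le hs hd _ p hp).1.congr_of_eventuallyEq (V_eq p hp)
  -- Uniform approach `V (z, μ) → ubar z` as `μ → 0`.
  have V_approx : ∀ ε > 0, ∃ ρ > 0, ∀ (z : E) (μ : ℝ), |μ| < ρ → |V (z, μ) - ubar z| ≤ ε := by
    intro ε hε
    obtain ⟨K, hK⟩ := ha (ε / 3) (by positivity)
    refine ⟨Real.exp (-K), Real.exp_pos _, fun z μ hμ => ?_⟩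
    by_cases hμ0 : μ = 0
    · simp [hV, hμ0, hε.le]
    have ht : (K : ℝ) < -Real.log μ := by
      rw [← Real.log_abs]
      linarith [(Real.log_lt_iff_lt_exp (abs_pos.mpr hμ0)).2 hμ]
    simp only [hV, hμ0, if_false]
    set k := ⌊-Real.log μ⌋₊ with hk_def
    have hk : K ≤ k := Nat.le_floor ht.le
    have e1 := abs_le.1 (hK k hk z)
    have e2 := abs_le.1 (hK (k + 1) (by omega) z)
    have hϑ0 := Real.smoothTransition.nonneg (4 * (-Real.log μ - k) - 1)
    have hϑ1 := Real.smoothTransition.le_one (4 * (-Real.log μ - k) - 1)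
    rw [abs_le]
    constructor <;> nlinarith [mul_nonneg hϑ0 (by linarith : 0 ≤ h (k + 1) z - ubar z + ε / 3),
      mul_nonneg hϑ0 (by linarith : 0 ≤ ε / 3 - (h (k + 1) z - ubar z)),
      mul_nonneg (sub_nonneg.2 hϑ1) (by linarith : 0 ≤ h k z - ubar z + ε / 3),
      mul_nonneg (sub_nonneg.2 hϑ1) (by linarith : 0 ≤ ε / 3 - (h k z - ubar z))]
  -- `‖μ • D V (z, μ)‖ → 0` as `μ → 0`, uniformly in `z`.
  have V_small : ∀ ε > 0, ∃ ρ > 0, ∀ p : E × ℝ, p.2 ≠ 0 → |p.2| < ρ →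
      ‖p.2 • fderiv ℝ V p‖ ≤ ε := by
    intro ε hε
    -- A bound `Θ` for `|smoothTransition'|` on `[-1, 3]`.
    obtain ⟨Θ, hΘ⟩ := isCompact_Icc.exists_bound_of_continuousOn (s := Icc (-1 : ℝ) 3)
      ((Real.smoothTransition.contDiff (n := 1)).continuous_deriv le_rfl).continuousOn
    have hΘ0 : 0 ≤ Θ := (norm_nonneg _).trans (hΘ 0 ⟨by norm_num, by norm_num⟩)
    obtain ⟨K₁, hK₁⟩ := ha (ε / (16 * (Θ + 1))) (by positivity)
    -- `e^{-k} · 3 (k + 1 + c₀) → 0`.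
    have hlim : Tendsto (fun k : ℕ => Real.exp (-(k : ℝ)) * (3 * ((k : ℝ) + 1 + c₀)))
        atTop (𝓝 0) := by
      have h3 := (((Real.tendsto_pow_mul_exp_neg_atTop_nhds_zero 1).const_mul 3).add
        (Real.tendsto_exp_neg_atTop_nhds_zero.const_mul (3 * (1 + c₀)))).comp
          tendsto_natCast_atTop_atTop
      simp only [mul_zero, add_zero] at h3
      refine h3.congr fun k => ?_
      simp only [Function.comp_apply, pow_one]
      ring
    obtain ⟨K₂, hK₂⟩ := eventually_atTop.1 (hlim.eventually (eventually_le_nhds (half_pos hε)))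
    refine ⟨Real.exp (-((max K₁ K₂ : ℕ) : ℝ)), Real.exp_pos _, fun p hp hρ => ?_⟩
    have hpos : 0 < |p.2| := abs_pos.mpr hp
    have ht : ((max K₁ K₂ : ℕ) : ℝ) < -Real.log p.2 := by
      rw [← Real.log_abs]
      linarith [(Real.log_lt_iff_lt_exp hpos).2 hρ]
    have ht0 : 0 ≤ -Real.log p.2 := le_trans (Nat.cast_nonneg _) ht.le
    have hk : max K₁ K₂ ≤ ⌊-Real.log p.2⌋₊ := Nat.le_floor ht.le
    rw [(V_eq p hp).fderiv_eq]
    set k := ⌊-Real.log p.2⌋₊ with hk_def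
    have hkt : (k : ℝ) ≤ -Real.log p.2 := Nat.floor_le ht0
    have hμk : |p.2| ≤ Real.exp (-(k : ℝ)) := by
      rw [← Real.log_le_iff_le_exp hpos, Real.log_abs]
      linarith
    have hτ : |deriv Real.smoothTransition (4 * (-Real.log p.2 - k) - 1)| ≤ Θ := by
      simpa [Real.norm_eq_abs] using
        hΘ _ ⟨by linarith, by linarith [Nat.lt_floor_add_one (-Real.log p.2)]⟩
    have hΔ : |h (k + 1) p.1 - h k p.1| ≤ 2 * (ε / (16 * (Θ + 1))) := by
      have e1 := abs_le.1 (hK₁ k (le_of_max_le_left hk) p.1)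
      have e2 := abs_le.1 (hK₁ (k + 1) (by omega) p.1)
      exact abs_le.2 ⟨by linarith [e1.2, e2.1], by linarith [e1.1, e2.2]⟩
    have hlast : 2 * (ε / (16 * (Θ + 1))) * (4 * Θ) ≤ ε / 2 := by
      rw [show 2 * (ε / (16 * (Θ + 1))) * (4 * Θ) = ε / 2 * (Θ / (Θ + 1)) by field_simp; ring]
      exact mul_le_of_le_one_right (half_pos hε).le ((div_le_one (by positivity)).2 (by linarith))
    calc _ ≤ |p.2| * (3 * ((k : ℝ) + 1 + c₀)) + |h (k + 1) p.1 - h k p.1| *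
          (4 * |deriv Real.smoothTransition (4 * (-Real.log p.2 - k) - 1)|) :=
          (strip_contDiffAt_norm_le hs hd k p hp).2
      _ ≤ Real.exp (-(k : ℝ)) * (3 * ((k : ℝ) + 1 + c₀)) + 2 * (ε / (16 * (Θ + 1))) * (4 * Θ) := by
          gcongr
      _ ≤ ε / 2 + ε / 2 := add_le_add (hK₂ k (le_of_max_le_right hk)) hlast
      _ = ε := add_halves ε
  -- Continuity of `V`.
  have V_cont : Continuous V := by
    refine continuous_iff_continuousAt.2 fun p => ?_
    by_cases hp : p.2 = 0
    · rw [ContinuousAt, Metric.tendsto_nhds]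
      intro ε hε
      obtain ⟨ρ, hρ, hρV⟩ := V_approx (ε / 2) (half_pos hε)
      have h2 : ∀ᶠ q : E × ℝ in 𝓝 p, dist (ubar q.1) (ubar p.1) < ε / 2 :=
        Metric.tendsto_nhds.1 ((hu.comp continuous_fst).continuousAt) (ε / 2) (half_pos hε)
      filter_upwards [eventually_abs_snd_lt p hp hρ, h2] with q hq1 hq2
      rw [hV0 p hp, Real.dist_eq]
      rw [Real.dist_eq] at hq2
      have hVq : |V q - ubar q.1| ≤ ε / 2 := hρV q.1 q.2 hq1
      calc |V q - ubar p.1| ≤ |V q - ubar q.1| + |ubar q.1 - ubar p.1| := abs_sub_le _ _ _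
        _ < ε := by linarith
    · exact (V_smooth p hp).continuousAt
  -- At the axis `μ = 0`, `W = μ V` has derivative `ubar z • snd`.
  have W_axis : ∀ p : E × ℝ, p.2 = 0 →
      HasFDerivAt (fun q : E × ℝ => q.2 * V q) (ubar p.1 • ContinuousLinearMap.snd ℝ E ℝ) p := by
    intro p hp
    rw [hasFDerivAt_iff_isLittleO, Asymptotics.isLittleO_iff]
    intro c hc
    filter_upwards [Metric.tendsto_nhds.1 (V_cont.continuousAt (x := p)) c hc] with q hq
    rw [hV0 p hp, Real.dist_eq] at hq
    have hq2 : |q.2| ≤ ‖q - p‖ := by simpa [hp, Real.norm_eq_abs] using norm_snd_le (q - p)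
    have hval : q.2 * V q - p.2 * V p - (ubar p.1 • ContinuousLinearMap.snd ℝ E ℝ) (q - p) =
        q.2 * (V q - ubar p.1) := by
      simp only [smul_apply, ContinuousLinearMap.coe_snd', Prod.snd_sub, hp, smul_eq_mul]
      ring
    rw [hval, Real.norm_eq_abs, abs_mul]
    calc |q.2| * |V q - ubar p.1| ≤ ‖q - p‖ * c :=
          mul_le_mul hq2 hq.le (abs_nonneg _) (norm_nonneg _)
      _ = c * ‖q - p‖ := mul_comm _ _
  -- `W = μ V` is `C¹`, with derivative `V • snd + μ • D V`.
  refine ⟨V, fun z => hV0 (z, 0) rfl, V_smooth, V_cont, contDiff_one_iff_hasFDerivAt.2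
    ⟨fun p => V p • ContinuousLinearMap.snd ℝ E ℝ + p.2 • fderiv ℝ V p, ?_, fun p => ?_⟩, W_axis⟩
  · refine (V_cont.smul continuous_const).add (continuous_iff_continuousAt.2 fun p => ?_)
    by_cases hp : p.2 = 0
    · rw [ContinuousAt, hp, zero_smul, NormedAddGroup.tendsto_nhds_zero]
      intro ε hε
      obtain ⟨ρ, hρ, H⟩ := V_small (ε / 2) (half_pos hε)
      filter_upwards [eventually_abs_snd_lt p hp hρ] with q hq
      by_cases hq0 : q.2 = 0
      · simp [hq0, hε]
      · exact (H q hq0 hq).trans_lt (half_lt_self hε)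
    · exact continuous_snd.continuousAt.smul ((V_smooth p hp).continuousAt_fderiv (by simp))
  · by_cases hp : p.2 = 0
    · simpa [hV0 p hp, hp] using W_axis p hp
    · have H := (hasFDerivAt_snd (p := p) (𝕜 := ℝ) (E := E) (F := ℝ)).mul
        ((V_smooth p hp).differentiableAt (by simp)).hasFDerivAt
      rwa [add_comm] at H

/-- Re-indexing smooth approximants `g m → ubar`, `|g m - ubar| ≤ 2⁻ᵐ`, `‖D (g m)‖ ≤ C m`, into a
sequence with a linear derivative budget: `h k := g (m k)`, `m k := Nat.findGreatest (C · ≤ k) k`.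
-/
theorem exists_reindex {ubar : E → ℝ} {g : ℕ → E → ℝ} {C : ℕ → ℝ}
    (hg : ∀ m, ContDiff ℝ ∞ (g m)) (hC : ∀ m z, ‖fderiv ℝ (g m) z‖ ≤ C m)
    (happ : ∀ m z, |g m z - ubar z| ≤ (1 / 2) ^ m) :
    ∃ h : ℕ → E → ℝ, (∀ k, ContDiff ℝ ∞ (h k)) ∧ (∀ (k : ℕ) z, ‖fderiv ℝ (h k) z‖ ≤ k + C 0) ∧
      ∀ ε > 0, ∃ K : ℕ, ∀ k ≥ K, ∀ z, |h k z - ubar z| ≤ ε := by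
  refine ⟨fun k => g (Nat.findGreatest (fun m => C m ≤ (k : ℝ)) k), fun k => hg _,
    fun k z => (hC _ z).trans ?_, fun ε hε => ?_⟩
  · have hc0 : 0 ≤ C 0 := (norm_nonneg _).trans (hC 0 z)
    have hk0 : (0 : ℝ) ≤ k := Nat.cast_nonneg k
    rcases eq_or_ne (Nat.findGreatest (fun m => C m ≤ (k : ℝ)) k) 0 with h0 | h0
    · rw [h0]
      linarith
    · linarith [Nat.findGreatest_of_ne_zero rfl h0]
  · obtain ⟨m₀, hm₀⟩ := exists_pow_lt_of_lt_one hε (by norm_num : (1 / 2 : ℝ) < 1)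
    refine ⟨max m₀ ⌈C m₀⌉₊, fun k hk z => (happ _ z).trans ?_⟩
    have hCk : C m₀ ≤ k := (Nat.le_ceil _).trans (by exact_mod_cast le_of_max_le_right hk)
    exact (pow_le_pow_of_le_one (by norm_num) (by norm_num)
      (Nat.le_findGreatest (le_of_max_le_left hk) hCk)).trans hm₀.le

end SmoothingFamily

open SmoothingFamily in
/-- **Smoothing family.** For a continuous `u` on a closed smooth `4`-manifold `M` there is a
continuous `U : M × ℝ → ℝ` with `U (·, 0) = u`, smooth off `M × {0}`, such that
`(x, λ) ↦ λ U (x, λ)` is `C¹` with differential `(v, s) ↦ s u x` along `M × {0}`. -/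
theorem stub_smoothingFamily
    (M : Type) [TopologicalSpace M] [T2Space M] [SecondCountableTopology M]
    [ChartedSpace (EuclideanSpace ℝ (Fin 4)) M] [IsManifold (𝓡 4) ∞ M] [CompactSpace M]
    (u : M → ℝ) (hu : Continuous u) :
    ∃ U : M × ℝ → ℝ, Continuous U ∧ (∀ x : M, U (x, 0) = u x) ∧
      ContMDiffOn ((𝓡 4).prod 𝓘(ℝ, ℝ)) 𝓘(ℝ, ℝ) ∞ U (univ ×ˢ {0}ᶜ) ∧
      ContMDiff ((𝓡 4).prod 𝓘(ℝ, ℝ)) 𝓘(ℝ, ℝ) 1 (fun p : M × ℝ => p.2 * U p) ∧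
      ∀ (x : M) (v : TangentSpace (𝓡 4) x) (s : ℝ),
        mfderiv ((𝓡 4).prod 𝓘(ℝ, ℝ)) 𝓘(ℝ, ℝ) (fun p : M × ℝ => p.2 * U p) (x, 0) (v, s)
          = s * u x := by
  -- Whitney embedding `e : M → ℝ^N`, Tietze extension `u₀` of `u`, cutoff `χ = 1` on `e(M)`.
  obtain ⟨N, e, he, hemb, -⟩ := exists_embedding_euclidean_of_compact (I := 𝓡 4) (M := M)
  obtain ⟨u₀, hu₀⟩ := ContinuousMap.exists_extension' hemb ⟨u, hu⟩
  obtain ⟨χ, hχ1, -, hχc, -⟩ := exists_continuous_one_zero_of_isCompact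
    (isCompact_range hemb.continuous) isClosed_empty (disjoint_empty _)
  have hue : ∀ x, χ (e x) * u₀ (e x) = u x := fun x => by
    rw [hχ1 ⟨x, rfl⟩, Pi.one_apply, one_mul]
    exact congrFun hu₀ x
  -- Smooth compactly supported approximants of `ubar := χ u₀`, with bounded derivatives.
  have happ : ∀ m : ℕ, ∃ g : EuclideanSpace ℝ (Fin N) → ℝ, ContDiff ℝ ∞ g ∧
      (∀ z, |g z - χ z * u₀ z| ≤ (1 / 2) ^ m) ∧ ∃ C : ℝ, ∀ z, ‖fderiv ℝ g z‖ ≤ C := fun m => by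
    obtain ⟨g, hg, hgε, hsupp⟩ := (χ.continuous.mul u₀.continuous).exists_contDiff_approx ⊤
      (ε := fun _ => (1 / 2 : ℝ) ^ m) continuous_const (fun _ => by positivity)
    exact ⟨g, hg, fun z => by simpa [Real.dist_eq] using (hgε z).le,
      (hg.continuous_fderiv (by simp)).bounded_above_of_compact_support
        (((hχc.mul_right (f' := u₀)).mono hsupp).fderiv (𝕜 := ℝ))⟩
  choose g hg_smooth hg_app hC using happ
  choose C hC using hC
  -- The analytic family on `ℝ^N × ℝ`, pulled back along `ê (x, λ) = (e x, λ)`.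
  obtain ⟨h, hs, hd, ha⟩ := exists_reindex hg_smooth hC hg_app
  obtain ⟨V, hV0, hVs, hVc, hW, hWa⟩ := exists_family (χ.continuous.mul u₀.continuous) hs hd ha
  set ê : M × ℝ → EuclideanSpace ℝ (Fin N) × ℝ := fun p => (e p.1, p.2) with hê_def
  have hê : ContMDiff ((𝓡 4).prod 𝓘(ℝ, ℝ)) 𝓘(ℝ, EuclideanSpace ℝ (Fin N) × ℝ) ∞ ê :=
    (he.comp contMDiff_fst).prodMk_space contMDiff_snd
  refine ⟨fun p => V (ê p), hVc.comp hê.continuous, fun x => (hV0 _).trans (hue x),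
    fun p hp => ((hVs (ê p) (by simpa using hp)).comp_contMDiffAt hê.contMDiffAt).contMDiffWithinAt,
    hW.comp_contMDiff (hê.of_le (by norm_num)), fun x v s => ?_⟩
  have hW' := hasMFDerivAt_iff_hasFDerivAt.2 (hWa (ê (x, 0)) rfl)
  -- `HasMFDerivAt` of `ê`, as in `MDifferentiableAt.prodMk_space`.
  have h1 := ((he.mdifferentiableAt (by simp)).hasMFDerivAt).comp (x, (0 : ℝ))
    (hasMFDerivAt_fst (I := 𝓡 4) (I' := 𝓘(ℝ, ℝ)) _)
  have h2 := hasMFDerivAt_snd (I := 𝓡 4) (I' := 𝓘(ℝ, ℝ)) (x, (0 : ℝ))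
  have hê' : HasMFDerivAt ((𝓡 4).prod 𝓘(ℝ, ℝ)) 𝓘(ℝ, EuclideanSpace ℝ (Fin N) × ℝ) ê (x, 0)
      (((mfderiv (𝓡 4) 𝓘(ℝ, EuclideanSpace ℝ (Fin N)) e x).comp
        (ContinuousLinearMap.fst ℝ (EuclideanSpace ℝ (Fin 4)) ℝ)).prod
        (ContinuousLinearMap.snd ℝ (EuclideanSpace ℝ (Fin 4)) ℝ)) :=
    ⟨h1.1.prodMk h2.1, h1.2.prodMk h2.2⟩
  rw [show (fun p : M × ℝ => p.2 * V (ê p)) = (fun q : EuclideanSpace ℝ (Fin N) × ℝ =>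
    q.2 * V q) ∘ ê from rfl, (hW'.comp (x, 0) hê').mfderiv]
  show (χ (e x) * u₀ (e x)) * s = s * u x
  rw [hue x, mul_comm]

end Summit.SmoothPoincare4.SmoothPoincare4.Cruxes.AhHadamardFilling.EinsteinBulkTransfer
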